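import Summits.AtomisticToContinuum.BoseEinsteinCondensation.Theses.BECZeroCrossingDilute
import Summits.AtomisticToContinuum.BoseEinsteinCondensation.Theorems.BECStronglyRayleighGroundStateStabilitySectorPerron
import Summits.AtomisticToContinuum.BoseEinsteinCondensation.Theorems.BECStronglyRayleighPenaltySelectsSector
import Summits.AtomisticToContinuum.BoseEinsteinCondensation.Theorems.BECStronglyRayleighLatticeCoherenceAssemblyGroundSpace
import Summits.AtomisticToContinuum.BoseEinsteinCondensation.Theorems.BECZeroCrossingDiluteNearIsotropicDiluteBECPlanarDeficit
import Summits.AtomisticToContinuum.BoseEinsteinCondensation.Theorems.InsertionFieldDelocalisation.Negative.PerronExistence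
import Literature.MathematicalPhysics.QuantumLattice.SpinChargeKinematics
import Literature.MathematicalPhysics.QuantumLattice.LiebMattisSectorPF
import Literature.MathematicalPhysics.QuantumLattice.SpinChainsAkltCorrelationProofs
import Literature.MathematicalPhysics.QuantumLattice.SectorEigenvalueContinuation
import Literature.MathematicalPhysics.QuantumLattice.SpinHalfWeightSectorCounts
import Literature.MathematicalPhysics.QuantumLattice.TrialVectorRayleighBound
import HarnessLib

/-!
# Kinetic variational bound for the penalised easy-plane XXZ ferromagnet on `(ℤ/Lℤ)³`
# (stub `stub_kineticVariational`, line `birth`, crux `NearIsotropicDiluteBEC` = stmt-AtomisticToContinuum-13905,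
# route BECZeroCrossingDilute, sub-problem BoseEinsteinCondensation)

**Statement.** Let `G` be the torus graph on `Λ = TorusSite 3 L = (ℤ/Lℤ)³` (`V = L³` sites,
`L ≥ 2`), `H_Δ = xxzHamiltonian 1 G (-1) Δ = -Σ_{xy}(S¹S¹ + S²S² + Δ S³S³)` the spin-`½` easy-plane
XXZ ferromagnet (`0 ≤ Δ ≤ 1`), `Q = S³_tot + (L³/2 - N)·1` (`N ≤ L³`) and `K = H_Δ + 4L³ Q²`. For
every unit ground vector `ψ` of `K` with `Qψ = 0`, the nearest-neighbour stirring energy obeys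
`𝓔(ψ) := Σ_x Σ_y [x ∼ y] Re⟨ψ, (1 - T_xy)ψ⟩ ≤ 12 (1 - Δ) N² / L³`
(ordered pairs; `T_xy = permOp (Equiv.swap x y)` transposes the spins at `x` and `y`).

**Proof.** (1) *Variational principle* (`groundSpace_rayleigh_mul_le`): `K` is Hermitian and `ψ`
a unit ground vector, so `Re⟨ψ,Kψ⟩‖φ‖² ≤ Re⟨φ,Kφ⟩` for every `φ`; on `ker Q` — the vectors
supported in the weight sector `S = {σ : W(σ) = L³ - N}`
(`LatticeCoherence.penalty_mulVec_eq_zero_iff`, `mem_sector_iff_weight`) — `K` acts as `H_Δ`.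
(2) *Stirring form* (`nidB3_re_quad_xxz`): `H_Δ = -H_Heis + (1-Δ) diag(D)` with
`D(σ) = Σ_{xy∈E}(½-σ_x)(½-σ_y)` (`leadPF_ham_eq` at zero field) and Dirac's exchange identity
`𝐒_x·𝐒_y = ½T_xy - ¼` (`nidB1_permOp_swap_eq`) give
`Re⟨χ,H_Δχ⟩ = ¼𝓔(χ) - ⅛‖χ‖² Σ_{x,y}[x∼y] + (1-Δ) Σ_σ D(σ)|χ(σ)|²`.
(3) *Trial state*: the uniform sector vector `φ = 1_S` is fixed by every `T_xy`
(`permOp_mulVec_weightIndicator`), so `𝓔(φ) = 0`. (4) The torus is regular of degree `δ`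
(`torusGraph_sum_ite_adj_eq`; `δV = 2|E| ≤ 6V`), so on `S`, `2D(σ) = A(σ) - δN + δV/4` with
`A(σ) = Σ_{x,y}[x∼y] n_x n_y ≥ 0` the number of ordered up–up bonds, `n_x = 1 - σ_x`
(`regularGraph_sum_boole_half_sub_mul`); hence (1)–(3) give `𝓔(ψ)|S| ≤ 2(1-Δ) Σ_{σ∈S} A(σ)`, and
by exchangeability of the uniform measure on `S` (`weightSector_upup_count`)
`V(V-1) Σ_{σ∈S} A(σ) = δV|S|N(N-1)`. So `𝓔(ψ)(V-1) ≤ 2(1-Δ)δN(N-1)` (`nidB3_core`) and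
`𝓔(ψ) ≤ 12(1-Δ)N²/V` since `δ ≤ 6` and `N ≤ V`.

**Sources.** E. H. Lieb, R. Seiringer, J. P. Solovej, J. Yngvason, *The Mathematics of the Bose
Gas and its Condensation* (Birkhäuser, 2005), Ch. 5 (variational upper bounds with uniform /
product trial states); B. Tóth, *Improved lower bound on the thermodynamic pressure of the spin 1/2
Heisenberg ferromagnet*, Lett. Math. Phys. 28 (1993) 75–84 (the ferromagnet as the interchange
process, `H_Heis = -½Σ_{xy}(T_xy - 1) + const`); P. A. M. Dirac, *The Principles of Quantum
Mechanics*, §58; H. Tasaki, *Physics and Mathematics of Quantum Many-Body Systems* (2020), §2.1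
(variational principle), §2.4. Finite-dimensional linear algebra and counting throughout.
[folklore]
-/

noncomputable section

namespace Summit.AtomisticToContinuum.BoseEinsteinCondensation.Cruxes.NearIsotropicDiluteBEC.Birth

open scoped BigOperators Matrix ComplexOrder
open Literature.MathematicalPhysics.QuantumLattice Literature.Probability.LatticeModels Matrix Complex Finset
open Summit.AtomisticToContinuum.BoseEinsteinCondensation.Theorems
open Summit.AtomisticToContinuum.BoseEinsteinCondensation.Cruxes.GroundStateStability.StableConeVariationalSelection

/-! ### The easy-plane XXZ quadratic form as a stirring form plus a diagonal -/

section Generic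

variable {Λ : Type*} [Fintype Λ] [DecidableEq Λ] (G : SimpleGraph Λ) [DecidableRel G.Adj]

/-- **Dirac's exchange identity in quadratic form**: for `x ≠ y` and every vector `χ`,
`Re⟨χ, 𝐒_x·𝐒_y χ⟩ = ¼‖χ‖² - ½ Re⟨χ, (1 - T_xy)χ⟩`, from `T_xy = 2 𝐒_x·𝐒_y + ½`
(`nidB1_permOp_swap_eq`). Dirac, *Principles* §58; Tasaki (2020) §2.4. [folklore] -/
theorem nidB3_re_quad_spinDot {x y : Λ} (hxy : x ≠ y) (χ : TensorIndex Λ 2 → ℂ) :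
    (star χ ⬝ᵥ (spinDot 1 x y : Op Λ 2) *ᵥ χ).re =
      1 / 4 * (star χ ⬝ᵥ χ).re -
        1 / 2 * (star χ ⬝ᵥ ((1 : Op Λ 2) - permOp (Equiv.swap x y)) *ᵥ χ).re := by
  have hT : (star χ ⬝ᵥ (permOp (Equiv.swap x y) : Op Λ 2) *ᵥ χ).re =
      2 * (star χ ⬝ᵥ (spinDot 1 x y : Op Λ 2) *ᵥ χ).re + 1 / 2 * (star χ ⬝ᵥ χ).re := by
    rw [nidB1_permOp_swap_eq hxy, show (1 / 2 : ℂ) = ((1 / 2 : ℝ) : ℂ) by norm_num,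
      show (2 : ℂ) = ((2 : ℝ) : ℂ) by norm_num, penSel_re_quad_add, penSel_re_quad_real_smul,
      penSel_re_quad_real_smul, one_mulVec]
  rw [penSel_re_quad_sub, one_mulVec, hT]
  ring

/-- **The Heisenberg exchange form is a stirring form**: for spin `½`,
`Re⟨χ, Σ_{xy∈E} 𝐒_x·𝐒_y χ⟩ = ⅛ ‖χ‖² Σ_x Σ_y [x ∼ y] - ¼ Σ_x Σ_y [x ∼ y] Re⟨χ, (1 - T_xy)χ⟩`
(ordered pairs; `[x ∼ y]` the adjacency indicator): the edge sum as half an ordered-pair sum and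
Dirac's identity bond by bond. Tóth, Lett. Math. Phys. 28 (1993) 75–84, §2; Tasaki (2020) §2.4.
[folklore] -/
theorem nidB3_re_quad_heisenberg (χ : TensorIndex Λ 2 → ℂ) :
    (star χ ⬝ᵥ (heisenbergHamiltonian 1 G 1 : Op Λ 2) *ᵥ χ).re =
      1 / 8 * (star χ ⬝ᵥ χ).re * ∑ x, ∑ y, (if G.Adj x y then (1 : ℝ) else 0) -
        1 / 4 * ∑ x, ∑ y, (if G.Adj x y then (1 : ℝ) else 0) *
          (star χ ⬝ᵥ ((1 : Op Λ 2) - permOp (Equiv.swap x y)) *ᵥ χ).re := by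
  unfold heisenbergHamiltonian
  rw [penSel_re_quad_real_smul, penSel_re_quad_sum, one_mul,
    sum_edgeFinset_eq_half_sum_sum_boole_mul G]
  have h : ∀ x y, (if G.Adj x y then (1 : ℝ) else 0) *
      (star χ ⬝ᵥ (spinDotSym 1 s(x, y) : Op Λ 2) *ᵥ χ).re =
      1 / 4 * (star χ ⬝ᵥ χ).re * (if G.Adj x y then (1 : ℝ) else 0) -
        1 / 2 * ((if G.Adj x y then (1 : ℝ) else 0) *
          (star χ ⬝ᵥ ((1 : Op Λ 2) - permOp (Equiv.swap x y)) *ᵥ χ).re) := by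
    intro x y
    by_cases hxy : G.Adj x y
    · rw [if_pos hxy, spinDotSym_mk, nidB3_re_quad_spinDot hxy.ne χ]
      ring
    · rw [if_neg hxy]
      ring
  simp only [h, Finset.sum_sub_distrib, ← Finset.mul_sum]
  ring

/-- **The easy-plane XXZ form = stirring form + diagonal**: for every vector `χ`,
`Re⟨χ, H_Δ χ⟩ = -(⅛‖χ‖² Σ_{x,y}[x∼y] - ¼ Σ_{x,y}[x∼y] Re⟨χ,(1 - T_xy)χ⟩)
  + (Σ_σ (½ Σ_{x,y} [x∼y] (½ - σ_x)(½ - σ_y)) |χ(σ)|²) · (1 - Δ)`,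
from `H_Δ = -H_Heis + (1-Δ) diag(Σ_{xy∈E}(½-σ_x)(½-σ_y))` (`leadPF_ham_eq` at zero field) and
`nidB3_re_quad_heisenberg`. Tasaki (2020) §2.4. [folklore] -/
theorem nidB3_re_quad_xxz (Δ : ℝ) (χ : TensorIndex Λ 2 → ℂ) :
    (star χ ⬝ᵥ (xxzHamiltonian 1 G (-1) Δ : Op Λ 2) *ᵥ χ).re =
      -(1 / 8 * (star χ ⬝ᵥ χ).re * ∑ x, ∑ y, (if G.Adj x y then (1 : ℝ) else 0) -
          1 / 4 * ∑ x, ∑ y, (if G.Adj x y then (1 : ℝ) else 0) *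
            (star χ ⬝ᵥ ((1 : Op Λ 2) - permOp (Equiv.swap x y)) *ᵥ χ).re) +
        (∑ σ : TensorIndex Λ 2,
          (1 / 2 * ∑ x, ∑ y, (if G.Adj x y then (1 : ℝ) else 0) *
              ((1 / 2 - ((σ x : ℕ) : ℝ)) * (1 / 2 - ((σ y : ℕ) : ℝ)))) * ‖χ σ‖ ^ 2) * (1 - Δ) := by
  have hd := leadPF_ham_eq G Δ (fun _ => (0 : ℝ))
  simp only [Complex.ofReal_zero, zero_smul, Finset.sum_const_zero, add_zero, zero_mul] at hd
  rw [hd, penSel_re_quad_add, Matrix.neg_mulVec, dotProduct_neg, Complex.neg_re,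
    nidB3_re_quad_heisenberg G χ, penSel_re_quad_diagonal, Finset.sum_mul]
  congr 1
  refine Finset.sum_congr rfl fun σ _ => ?_
  rw [sum_edgeFinset_eq_half_sum_sum_boole_mul G]
  simp only [Sym2.lift_mk]
  ring

/-- **Core of the kinetic variational bound.** Let `G` be a graph on `Λ` with `Σ_w [v∼w] = δ`
for all `v` and `2 ≤ |Λ|`; let `w + M = |Λ|` and let `ψ` be a unit vector supported in the weight
sector `S_w` (`M` up spins) whose XXZ energy is variationally minimal among vectors supported in
`S_w` (`Re⟨ψ,H_Δψ⟩‖φ‖² ≤ Re⟨φ,H_Δφ⟩`). Then the nearest-neighbour stirring form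
`𝓔(ψ) = Σ_{x,y}[x∼y] Re⟨ψ,(1-T_xy)ψ⟩` satisfies `𝓔(ψ)(|Λ| - 1) ≤ 2(1-Δ) δ M(M-1)`.
Proof: test against the uniform sector vector `φ = 1_{S_w}`, which is fixed by every `T_xy`
(`𝓔(φ) = 0`); by `nidB3_re_quad_xxz` and `regularGraph_sum_boole_half_sub_mul` the energies
differ by the stirring form and `(1-Δ)/2` times the expected number of ordered up–up bonds, which
for `φ` is
`δ|Λ| · M(M-1)/(|Λ|(|Λ|-1))` by exchangeability (`weightSector_upup_count`) and is `≥ 0` for `ψ`.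
Lieb–Seiringer–Solovej–Yngvason (2005) Ch. 5 (variational principle); Tóth (1993). [folklore] -/
theorem nidB3_core {δ : ℝ} (hreg : ∀ v, ∑ u, (if G.Adj v u then (1 : ℝ) else 0) = δ)
    (hV : 1 < Fintype.card Λ) (Δ : ℝ) (hΔ1 : Δ ≤ 1) (w M : ℕ) (hwM : w + M = Fintype.card Λ)
    (ψ : TensorIndex Λ 2 → ℂ) (hsupp : ∀ σ, (∑ z, (σ z : ℕ)) ≠ w → ψ σ = 0)
    (hψ1 : star ψ ⬝ᵥ ψ = 1)
    (hvar : ∀ φ : TensorIndex Λ 2 → ℂ, (∀ σ, (∑ z, (σ z : ℕ)) ≠ w → φ σ = 0) →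
      (star ψ ⬝ᵥ (xxzHamiltonian 1 G (-1) Δ : Op Λ 2) *ᵥ ψ).re * (star φ ⬝ᵥ φ).re ≤
        (star φ ⬝ᵥ (xxzHamiltonian 1 G (-1) Δ : Op Λ 2) *ᵥ φ).re) :
    (∑ x, ∑ y, (if G.Adj x y then (1 : ℝ) else 0) *
        (star ψ ⬝ᵥ ((1 : Op Λ 2) - permOp (Equiv.swap x y)) *ᵥ ψ).re) *
        ((Fintype.card Λ : ℝ) - 1) ≤
      2 * (1 - Δ) * δ * ((M : ℝ) * ((M : ℝ) - 1)) := by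
  -- the uniform sector vector and the basic quantities
  set φ : TensorIndex Λ 2 → ℂ := fun σ => if (∑ z, (σ z : ℕ)) = w then (1 : ℂ) else 0 with hφ
  set s : ℝ := ∑ σ : TensorIndex Λ 2, (if (∑ z, (σ z : ℕ)) = w then (1 : ℝ) else 0) with hs
  set E : ℝ := ∑ x, ∑ y, (if G.Adj x y then (1 : ℝ) else 0) *
    (star ψ ⬝ᵥ ((1 : Op Λ 2) - permOp (Equiv.swap x y)) *ᵥ ψ).re with hE
  set Aψ : ℝ := ∑ σ : TensorIndex Λ 2, (∑ x, ∑ y, (if G.Adj x y then (1 : ℝ) else 0) *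
    ((1 - ((σ x : ℕ) : ℝ)) * (1 - ((σ y : ℕ) : ℝ)))) * ‖ψ σ‖ ^ 2 with hAψ
  set Aφ : ℝ := ∑ σ : TensorIndex Λ 2, (∑ x, ∑ y, (if G.Adj x y then (1 : ℝ) else 0) *
    ((1 - ((σ x : ℕ) : ℝ)) * (1 - ((σ y : ℕ) : ℝ)))) * ‖φ σ‖ ^ 2 with hAφ
  have hVw : (Fintype.card Λ : ℝ) - w = M := by
    have h : ((w + M : ℕ) : ℝ) = Fintype.card Λ := by exact_mod_cast hwM
    push_cast at h
    linarith
  have hconst : ∑ x, ∑ y, (if G.Adj x y then (1 : ℝ) else 0) = Fintype.card Λ * δ := by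
    rw [Finset.sum_congr rfl fun x _ => hreg x, Finset.sum_const, Finset.card_univ, nsmul_eq_mul]
  have hn0 : ∀ (σ : TensorIndex Λ 2) (x : Λ), (0 : ℝ) ≤ 1 - ((σ x : ℕ) : ℝ) := fun σ x =>
    sub_nonneg.2 (by exact_mod_cast Nat.lt_succ_iff.1 (σ x).isLt)
  have ha0 : ∀ x y, (0 : ℝ) ≤ (if G.Adj x y then (1 : ℝ) else 0) := fun x y => by
    split_ifs <;> norm_num
  -- the up-spin number is `M` on the sector
  have hU : ∀ σ : TensorIndex Λ 2, (∑ z, (σ z : ℕ)) = w → ∑ x, (1 - ((σ x : ℕ) : ℝ)) = M := by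
    intro σ hσ
    rw [Finset.sum_sub_distrib, Finset.sum_const, Finset.card_univ, nsmul_eq_mul, mul_one, ← hVw,
      ← hσ]
    push_cast
    ring
  -- the diagonal term on sector-supported vectors
  have hdiag : ∀ χ : TensorIndex Λ 2 → ℂ, (∀ σ, (∑ z, (σ z : ℕ)) ≠ w → χ σ = 0) →
      ∑ σ : TensorIndex Λ 2, (1 / 2 * ∑ x, ∑ y, (if G.Adj x y then (1 : ℝ) else 0) *
          ((1 / 2 - ((σ x : ℕ) : ℝ)) * (1 / 2 - ((σ y : ℕ) : ℝ)))) * ‖χ σ‖ ^ 2 =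
        1 / 2 * ∑ σ : TensorIndex Λ 2, (∑ x, ∑ y, (if G.Adj x y then (1 : ℝ) else 0) *
          ((1 - ((σ x : ℕ) : ℝ)) * (1 - ((σ y : ℕ) : ℝ)))) * ‖χ σ‖ ^ 2 +
        1 / 2 * (δ * Fintype.card Λ / 4 - δ * M) * (star χ ⬝ᵥ χ).re := by
    intro χ hχ
    rw [EigenvalueContinuation.re_star_dotProduct_self, Finset.mul_sum, Finset.mul_sum,
      ← Finset.sum_add_distrib]
    refine Finset.sum_congr rfl fun σ _ => ?_
    rw [regularGraph_sum_boole_half_sub_mul G hreg fun x => ((σ x : ℕ) : ℝ)]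
    by_cases hσ : (∑ z, (σ z : ℕ)) = w
    · rw [hU σ hσ]
      ring
    · rw [hχ σ hσ, norm_zero]
      ring
  -- properties of the uniform sector vector
  have hφsupp : ∀ σ, (∑ z, (σ z : ℕ)) ≠ w → φ σ = 0 := fun σ hσ => if_neg hσ
  have hφnorm : ∀ σ, ‖φ σ‖ ^ 2 = if (∑ z, (σ z : ℕ)) = w then (1 : ℝ) else 0 := by
    intro σ
    by_cases hσ : (∑ z, (σ z : ℕ)) = w
    · rw [if_pos hσ, show φ σ = 1 from if_pos hσ, norm_one, one_pow]
    · rw [if_neg hσ, hφsupp σ hσ, norm_zero]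
      ring
  have hφφ : (star φ ⬝ᵥ φ).re = s := by
    rw [EigenvalueContinuation.re_star_dotProduct_self]
    exact Finset.sum_congr rfl fun σ _ => hφnorm σ
  have hEφ : ∀ x y, (star φ ⬝ᵥ ((1 : Op Λ 2) - permOp (Equiv.swap x y)) *ᵥ φ).re = 0 := by
    intro x y
    rw [sub_mulVec, one_mulVec, hφ, permOp_mulVec_weightIndicator, sub_self, dotProduct_zero,
      Complex.zero_re]
  -- the count `|Λ|(|Λ|-1) ⟨A⟩_φ = δ |Λ| s M(M-1)`
  have hAφ_eq : Aφ = ∑ x, ∑ y, (if G.Adj x y then (1 : ℝ) else 0) *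
      ∑ σ : TensorIndex Λ 2, (if (∑ z, (σ z : ℕ)) = w then (1 : ℝ) else 0) *
        ((1 - ((σ x : ℕ) : ℝ)) * (1 - ((σ y : ℕ) : ℝ))) := by
    rw [hAφ]
    simp only [hφnorm]
    exact sum_sum_sum_mul_comm _ (fun (σ : TensorIndex Λ 2) x y =>
      (1 - ((σ x : ℕ) : ℝ)) * (1 - ((σ y : ℕ) : ℝ))) _
  have hcount : (Fintype.card Λ : ℝ) * ((Fintype.card Λ : ℝ) - 1) * Aφ =
      δ * Fintype.card Λ * s * ((M : ℝ) * ((M : ℝ) - 1)) := by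
    rw [hAφ_eq, Finset.mul_sum]
    have h : ∀ x y, (Fintype.card Λ : ℝ) * ((Fintype.card Λ : ℝ) - 1) *
        ((if G.Adj x y then (1 : ℝ) else 0) *
          ∑ σ : TensorIndex Λ 2, (if (∑ z, (σ z : ℕ)) = w then (1 : ℝ) else 0) *
            ((1 - ((σ x : ℕ) : ℝ)) * (1 - ((σ y : ℕ) : ℝ)))) =
        (if G.Adj x y then (1 : ℝ) else 0) * (s * ((M : ℝ) * ((M : ℝ) - 1))) := by
      intro x y
      by_cases hxy : G.Adj x y
      · rw [if_pos hxy, one_mul, one_mul, weightSector_upup_count w hxy.ne, hVw]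
      · rw [if_neg hxy, zero_mul, zero_mul, mul_zero]
    rw [Finset.sum_congr rfl fun x _ => by rw [Finset.mul_sum]]
    simp only [h]
    rw [Finset.sum_congr rfl fun x _ => (Finset.sum_mul _ _ _).symm, ← Finset.sum_mul, hconst]
    ring
  -- positivity facts
  have hs0 : 0 < s := by
    obtain ⟨σ₀, hσ₀⟩ := penSel_exists_weight (Λ := Λ) (W := w) (by omega)
    have h := Finset.single_le_sum (s := Finset.univ)
      (f := fun σ : TensorIndex Λ 2 => if (∑ z, (σ z : ℕ)) = w then (1 : ℝ) else 0)
      (fun σ _ => by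
        show (0 : ℝ) ≤ if (∑ z, (σ z : ℕ)) = w then (1 : ℝ) else 0
        split_ifs <;> norm_num)
      (Finset.mem_univ σ₀)
    simp only [if_pos hσ₀] at h
    linarith
  have hAψ0 : 0 ≤ Aψ := by
    refine Finset.sum_nonneg fun σ _ => mul_nonneg ?_ (sq_nonneg _)
    exact Finset.sum_nonneg fun x _ => Finset.sum_nonneg fun y _ =>
      mul_nonneg (ha0 x y) (mul_nonneg (hn0 σ x) (hn0 σ y))
  have hV0 : (0 : ℝ) < Fintype.card Λ := by exact_mod_cast (zero_lt_one.trans hV)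
  have hV1 : (0 : ℝ) ≤ (Fintype.card Λ : ℝ) * ((Fintype.card Λ : ℝ) - 1) := by
    have h1 : (1 : ℝ) ≤ Fintype.card Λ := by exact_mod_cast hV.le
    nlinarith
  have h1Δ : 0 ≤ 1 - Δ := sub_nonneg.2 hΔ1
  -- the variational inequality, expanded
  have hEφ0 : ∑ x, ∑ y, (if G.Adj x y then (1 : ℝ) else 0) *
      (star φ ⬝ᵥ ((1 : Op Λ 2) - permOp (Equiv.swap x y)) *ᵥ φ).re = 0 :=
    Finset.sum_eq_zero fun x _ => Finset.sum_eq_zero fun y _ => by rw [hEφ x y, mul_zero]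
  have hineq := hvar φ hφsupp
  rw [nidB3_re_quad_xxz G Δ ψ, nidB3_re_quad_xxz G Δ φ, hdiag ψ hsupp, hdiag φ hφsupp, hψ1,
    Complex.one_re, hφφ, hEφ0] at hineq
  -- hineq : (-(⅛·1·ΣΣa - ¼E) + (1-Δ)(½Aψ + ½κ·1))·s ≤ -(⅛ s ΣΣa - 0) + (1-Δ)(½Aφ + ½κ s)
  rw [hconst] at hineq
  have hineq' : (-(1 / 8 * 1 * ((Fintype.card Λ : ℝ) * δ) - 1 / 4 * E) +
      (1 / 2 * Aψ + 1 / 2 * (δ * Fintype.card Λ / 4 - δ * M) * 1) * (1 - Δ)) * s ≤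
      -(1 / 8 * s * ((Fintype.card Λ : ℝ) * δ) - 1 / 4 * 0) +
        (1 / 2 * Aφ + 1 / 2 * (δ * Fintype.card Λ / 4 - δ * M) * s) * (1 - Δ) := hineq
  have hEs : E * s ≤ 2 * (1 - Δ) * Aφ := by
    nlinarith [hineq', mul_nonneg (mul_nonneg h1Δ hAψ0) hs0.le]
  have hfin : E * ((Fintype.card Λ : ℝ) - 1) * (s * Fintype.card Λ) ≤
      2 * (1 - Δ) * δ * ((M : ℝ) * ((M : ℝ) - 1)) * (s * Fintype.card Λ) := by
    calc E * ((Fintype.card Λ : ℝ) - 1) * (s * Fintype.card Λ)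
        = E * s * ((Fintype.card Λ : ℝ) * ((Fintype.card Λ : ℝ) - 1)) := by ring
      _ ≤ 2 * (1 - Δ) * Aφ * ((Fintype.card Λ : ℝ) * ((Fintype.card Λ : ℝ) - 1)) :=
          mul_le_mul_of_nonneg_right hEs hV1
      _ = 2 * (1 - Δ) * ((Fintype.card Λ : ℝ) * ((Fintype.card Λ : ℝ) - 1) * Aφ) := by ring
      _ = 2 * (1 - Δ) * (δ * Fintype.card Λ * s * ((M : ℝ) * ((M : ℝ) - 1))) := by rw [hcount]
      _ = 2 * (1 - Δ) * δ * ((M : ℝ) * ((M : ℝ) - 1)) * (s * Fintype.card Λ) := by ring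
  exact le_of_mul_le_mul_right hfin (mul_pos hs0 hV0)

end Generic

/-! ### The registered stub -/

/-- **Kinetic variational bound** (stub `stub_kineticVariational` of line `birth`, crux
`NearIsotropicDiluteBEC`). For `L ≥ 2`, `N ≤ L³`, `0 ≤ Δ ≤ 1` and a unit ground vector `ψ` of the
penalised easy-plane XXZ ferromagnet `K = H_Δ + 4L³(S³_tot + L³/2 - N)²` on `(ℤ/Lℤ)³` lying in the
sector `S³_tot = N - L³/2` (`N` up spins = `N` hard-core bosons), the nearest-neighbour stirring
energy `𝓔(ψ) = Σ_{x∼y} Re⟨ψ, (1 - T_xy)ψ⟩` (`T_xy = permOp (swap x y)`) is at most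
`12 (1-Δ) N²/L³`. Mechanism: `H_Δ = -H_Heis + (1-Δ) diag(Σ_{xy}(½-σ_x)(½-σ_y))` and
`H_Heis = Σ_{xy}(½T_xy - ¼)` (Dirac), so `Re⟨χ,H_Δχ⟩ = ¼𝓔(χ) - |E|/4 + (1-Δ)⟨D⟩_χ`; on `ker Q`
the penalised `K` equals `H_Δ`, so the variational principle against the uniform sector vector
`1_S` (fixed by every `T_xy`, `𝓔(1_S) = 0`) gives `𝓔(ψ) ≤ 4(1-Δ)(⟨D⟩_{1_S} - ⟨D⟩_ψ)`; by the
regularity of the torus the linear part of `D` is constant on the sector and the quadratic part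
(number of up–up bonds) is `≥ 0` for `ψ` and equals `|E| N(N-1)/(V(V-1)) ≤ 3N²/V` for `1_S`
(exchangeability). Lieb–Seiringer–Solovej–Yngvason, *The Mathematics of the Bose Gas* (2005),
Ch. 5; B. Tóth, Lett. Math. Phys. 28 (1993) 75; Tasaki (2020) §2.4. [folklore] -/
theorem stub_kineticVariational :
    ∃ C : ℝ, 0 < C ∧ ∀ (L : ℕ) [NeZero L], 2 ≤ L → ∀ N : ℕ, N ≤ L ^ 3 → ∀ Δ : ℝ, 0 ≤ Δ → Δ ≤ 1 → ∀ ψ : TensorIndex (TorusSite 3 L) 2 → ℂ, ψ ∈ (xxzHamiltonian 1 (torusGraph 3 L) (-1) Δ + (((3 + 1) * L ^ 3 : ℕ) : ℂ) • (totalSpin 1 2 + ((L : ℂ) ^ 3 / 2 - (N : ℂ)) • 1) ^ 2).groundSpace → ((totalSpin 1 2 : Op (TorusSite 3 L) 2) + ((L : ℂ) ^ 3 / 2 - (N : ℂ)) • 1) *ᵥ ψ = 0 → star ψ ⬝ᵥ ψ = 1 → (∑ x : TorusSite 3 L, ∑ y : TorusSite 3 L, if (torusGraph 3 L).Adj x y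 then (star ψ ⬝ᵥ ((1 : Op (TorusSite 3 L) 2) - permOp (Equiv.swap x y)) *ᵥ ψ).re else 0) ≤ C * (1 - Δ) * (N : ℝ) ^ 2 / (L : ℝ) ^ 3 := by
  refine ⟨12, by norm_num, ?_⟩
  intro L _ hL N hN Δ _hΔ0 hΔ1 ψ hψK hQψ hψ1
  have hcard : Fintype.card (TorusSite 3 L) = L ^ 3 :=
    InsertionFieldDelocalisation.Negative.card_torusSite 3 L
  -- regularity of the torus and the degree bound `δ ≤ 6`
  set δ : ℝ := ∑ u, (if (torusGraph 3 L).Adj 0 u then (1 : ℝ) else 0) with hδ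
  have hreg : ∀ v, ∑ u, (if (torusGraph 3 L).Adj v u then (1 : ℝ) else 0) = δ := fun v =>
    torusGraph_sum_ite_adj_eq v 1
  have hL0 : (0 : ℝ) < (L : ℝ) ^ 3 := pow_pos (by exact_mod_cast Nat.pos_of_ne_zero (NeZero.ne L)) 3
  have hδ6 : δ ≤ 6 := by
    have h2E := sum_sum_boole_adj_eq_two_mul_card_edgeFinset (torusGraph 3 L)
    rw [Finset.sum_congr rfl fun v _ => hreg v, Finset.sum_const, Finset.card_univ, hcard,
      nsmul_eq_mul] at h2E
    have hE : ((torusGraph 3 L).edgeFinset.card : ℝ) ≤ 3 * (L : ℝ) ^ 3 := by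
      exact_mod_cast penSel_card_edgeFinset_torusGraph_le 3 L
    push_cast at h2E
    nlinarith
  -- the penalised Hamiltonian: Hermitian, and equal to `H_Δ` on the kernel of the penalty
  set H : Op (TorusSite 3 L) 2 := xxzHamiltonian 1 (torusGraph 3 L) (-1) Δ with hHdef
  set Pen : Op (TorusSite 3 L) 2 := totalSpin 1 2 + ((L : ℂ) ^ 3 / 2 - (N : ℂ)) • 1 with hPendef
  set k : ℂ := (((3 + 1) * L ^ 3 : ℕ) : ℂ) with hkdef
  set K : Op (TorusSite 3 L) 2 := H + k • Pen ^ 2 with hKdef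
  have hKherm : K.IsHermitian := by
    have hsa : IsSelfAdjoint ((L : ℂ) ^ 3 / 2 - (N : ℂ)) := by
      rw [isSelfAdjoint_iff, show ((L : ℂ) ^ 3 / 2 - (N : ℂ)) = (((L : ℝ) ^ 3 / 2 - (N : ℝ) : ℝ) : ℂ)
        by push_cast; ring, Complex.star_def, Complex.conj_ofReal]
    have hk : IsSelfAdjoint k := by rw [isSelfAdjoint_iff, hkdef, Complex.star_def, map_natCast]
    exact (xxzHamiltonian_isHermitian 1 _ (-1) Δ).add
      ((((totalSpin_isHermitian 1 2).add (isHermitian_one.smul hsa)).pow 2).smul hk)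
  have hK_of_pen : ∀ φ : TensorIndex (TorusSite 3 L) 2 → ℂ, Pen *ᵥ φ = 0 → K *ᵥ φ = H *ᵥ φ := by
    intro φ hφ
    rw [hKdef, add_mulVec, smul_mulVec, pow_two, ← mulVec_mulVec, hφ, mulVec_zero, smul_zero,
      add_zero]
  -- `ψ` lives in the weight sector `L³ - N`, and is variationally minimal there
  have hsuppψ : ∀ σ, (∑ z, (σ z : ℕ)) ≠ L ^ 3 - N → ψ σ = 0 :=
    (LatticeCoherence.mem_sector_iff_weight 3 L N hN ψ).1
      ((LatticeCoherence.penalty_mulVec_eq_zero_iff 3 L N ψ).1 hQψ)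
  have hvar : ∀ φ : TensorIndex (TorusSite 3 L) 2 → ℂ, (∀ σ, (∑ z, (σ z : ℕ)) ≠ L ^ 3 - N → φ σ = 0) →
      (star ψ ⬝ᵥ H *ᵥ ψ).re * (star φ ⬝ᵥ φ).re ≤ (star φ ⬝ᵥ H *ᵥ φ).re := by
    intro φ hφ
    have hPenφ : Pen *ᵥ φ = 0 := (LatticeCoherence.penalty_mulVec_eq_zero_iff 3 L N φ).2
      ((LatticeCoherence.mem_sector_iff_weight 3 L N hN φ).2 hφ)
    have h := groundSpace_rayleigh_mul_le hKherm hψK hψ1 φ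
    rwa [hK_of_pen ψ hQψ, hK_of_pen φ hPenφ] at h
  -- the core bound `𝓔(ψ)(L³ - 1) ≤ 2(1-Δ) δ N(N-1)`
  have hwM : L ^ 3 - N + N = Fintype.card (TorusSite 3 L) := by rw [hcard, Nat.sub_add_cancel hN]
  have hV : 1 < Fintype.card (TorusSite 3 L) := by
    rw [hcard]
    calc 1 < 2 ^ 3 := by norm_num
      _ ≤ L ^ 3 := Nat.pow_le_pow_left hL 3
  have hcore := nidB3_core (torusGraph 3 L) hreg hV Δ hΔ1 (L ^ 3 - N) N hwM ψ hsuppψ hψ1 hvar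
  rw [hcard] at hcore
  push_cast at hcore
  -- conclusion: `𝓔 L³ (L³-1) ≤ 12(1-Δ)N²(L³-1)` since `δ ≤ 6` and `N ≤ L³`
  have hconv : (∑ x : TorusSite 3 L, ∑ y : TorusSite 3 L, if (torusGraph 3 L).Adj x y then
      (star ψ ⬝ᵥ ((1 : Op (TorusSite 3 L) 2) - permOp (Equiv.swap x y)) *ᵥ ψ).re else 0) =
      ∑ x : TorusSite 3 L, ∑ y : TorusSite 3 L, (if (torusGraph 3 L).Adj x y then (1 : ℝ) else 0) *
        (star ψ ⬝ᵥ ((1 : Op (TorusSite 3 L) 2) - permOp (Equiv.swap x y)) *ᵥ ψ).re :=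
    Finset.sum_congr rfl fun x _ => Finset.sum_congr rfl fun y _ => (boole_mul _ _).symm
  rw [hconv, le_div_iff₀ hL0]
  have hNX : (N : ℝ) ≤ (L : ℝ) ^ 3 := by exact_mod_cast hN
  have hN0 : (0 : ℝ) ≤ N := Nat.cast_nonneg N
  have hNN : (0 : ℝ) ≤ (N : ℝ) * ((N : ℝ) - 1) := by
    have h : (N : ℝ) ≤ (N : ℝ) ^ 2 := by exact_mod_cast Nat.le_self_pow two_ne_zero N
    nlinarith
  have h1Δ : 0 ≤ 1 - Δ := sub_nonneg.2 hΔ1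
  have hδ0 : 0 ≤ δ := Finset.sum_nonneg fun u _ => by
    show (0 : ℝ) ≤ if (torusGraph 3 L).Adj 0 u then (1 : ℝ) else 0
    split_ifs <;> norm_num
  have h8 : (2 : ℝ) ^ 3 ≤ (L : ℝ) ^ 3 := pow_le_pow_left₀ (by norm_num) (by exact_mod_cast hL) 3
  have hfin : (∑ x : TorusSite 3 L, ∑ y : TorusSite 3 L,
      (if (torusGraph 3 L).Adj x y then (1 : ℝ) else 0) *
        (star ψ ⬝ᵥ ((1 : Op (TorusSite 3 L) 2) - permOp (Equiv.swap x y)) *ᵥ ψ).re) *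
        (L : ℝ) ^ 3 * ((L : ℝ) ^ 3 - 1) ≤ 12 * (1 - Δ) * (N : ℝ) ^ 2 * ((L : ℝ) ^ 3 - 1) := by
    nlinarith [mul_le_mul_of_nonneg_left hcore hL0.le,
      mul_le_mul_of_nonneg_left hδ6 (by positivity : (0 : ℝ) ≤ 2 * (1 - Δ) * ((N : ℝ) * ((N : ℝ) - 1)) * (L : ℝ) ^ 3),
      mul_nonneg (mul_nonneg h1Δ hN0) (sub_nonneg.2 hNX)]
  exact le_of_mul_le_mul_right hfin (by linarith)

end Summit.AtomisticToContinuum.BoseEinsteinCondensation.Cruxes.NearIsotropicDiluteBEC.Birth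

end
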